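import Summits.CriticalPhenomena.CardyFormulaZ2.Theorems.CardySusyWardDiscretisationFamilyExistsInnerCells
import HarnessLib

/-!
# Common geometry of the legs — helper for `DiscretisationFamilyExists` (stmt-CriticalPhenomena-9644)

Coordinates of `Mesh.cell`.  Facts shared by the three leg shapes (straight, wide L, hook):

* the vertical run `segment (centre (k, y')) (centre (k, R))` through clean inner cells lies in
  `Ω` (`vertical_run_subset`), its points have `re = δ(k+½)` and `im ∈ [δ(y'+½), δ(R+½)]`
  (`re_im_of_mem_vertical_run`), and its grid points are the side midpoints `(δ(k+½), δ n)`,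
  `y' < n ≤ R` (`exists_eq_of_mem_vertical_run_of_mem_gridLines`);
* a closed lattice edge containing the midpoint of a horizontal (vertical) side is that side
  (`sym2_eq_of_midpoint_mem_segment_h/v`);
* the faces cornered at both ends of a horizontal (vertical) lattice edge are the two adjacent
  cells (`face_eq_of_isCorner_h/v`);
* points with a half-integer coordinate are not mesh points (`meshPoint_re_ne`, `meshPoint_im_ne`).
-/

noncomputable section

open Set Metric Complex
open Literature.Probability.LatticeModels Literature.Probability.Percolation
  Literature.Probability.LatticeModels.Mesh Literature.Probability.LatticeModels.DiscreteDobrushin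

namespace Summit.CriticalPhenomena.CardyFormulaZ2.Theorems.DiscretisationFamilyExists

/-! ### Half-integers -/

/-- A half-integer multiple of `δ > 0` is not an integer multiple (private instance of
`Mesh.ne_mul_int_of_mem_Ioo`, cf. `Mesh.half_ne_mul_int`). [folklore] -/
private theorem mul_add_half_ne_mul_int' {δ : ℝ} (hδ : 0 < δ) (n m : ℤ) : δ * (n + 1 / 2) ≠ δ * m := by
  intro h
  have h' : (n : ℝ) + 1 / 2 = m := by exact_mod_cast mul_left_cancel₀ hδ.ne' h
  have h2 : (2 * n + 1 : ℤ) = 2 * m := by exact_mod_cast (by linarith : (2 * n + 1 : ℝ) = 2 * m)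
  omega

/-- A point with `re = δ(k+½)` is not a mesh point. [folklore] -/
theorem meshPoint_re_ne {δ : ℝ} (hδ : 0 < δ) (k : ℤ) (x : Site 2) {z : ℂ}
    (hz : z.re = δ * (k + 1 / 2)) : meshPoint δ x ≠ z := by
  intro h
  have := congrArg Complex.re h
  rw [meshPoint_re, hz] at this
  exact mul_add_half_ne_mul_int' hδ k (x 0) this.symm

/-- A point with `im = δ(j+½)` is not a mesh point. [folklore] -/
theorem meshPoint_im_ne {δ : ℝ} (hδ : 0 < δ) (j : ℤ) (x : Site 2) {z : ℂ}
    (hz : z.im = δ * (j + 1 / 2)) : meshPoint δ x ≠ z := by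
  intro h
  have := congrArg Complex.im h
  rw [meshPoint_im, hz] at this
  exact mul_add_half_ne_mul_int' hδ j (x 1) this.symm

/-! ### The vertical run -/

/-- Coordinates on the vertical run: `re = δ(k+½)`, `im` between the two centres. [folklore] -/
theorem re_im_of_mem_vertical_run {δ : ℝ} (hδ : 0 < δ) {k y' R : ℤ} (hyR : y' ≤ R) {z : ℂ}
    (hz : z ∈ segment ℝ (cellCenter δ k y') (cellCenter δ k R)) :
    z.re = δ * (k + 1 / 2) ∧ δ * (y' + 1 / 2) ≤ z.im ∧ z.im ≤ δ * (R + 1 / 2) := by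
  rw [segment_eq_image'] at hz
  obtain ⟨θ, ⟨h0, h1⟩, rfl⟩ := hz
  simp only [add_re, add_im, Complex.real_smul, mul_re, mul_im, ofReal_re, ofReal_im, zero_mul,
    sub_zero, add_zero, sub_re, sub_im, cellCenter_re, cellCenter_im]
  have hyR' : (y' : ℝ) ≤ R := by exact_mod_cast hyR
  refine ⟨by ring, ?_, ?_⟩ <;> nlinarith [mul_nonneg hδ.le h0, mul_nonneg hδ.le (sub_nonneg.2 h1)]

/-- **The vertical run through inner cells lies in `Ω`** (regular `Ω`): every point is in an open
inner cell or on the open common side of two of them. [folklore] -/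
theorem vertical_run_subset {E : DiscreteDobrushin} (hΩ : IsOpen E.Ω)
    (hJE : frontier E.Ω ⊆ closure (closure E.Ω)ᶜ) (hext : IsConnected (closure E.Ω)ᶜ)
    (hunb : ¬ Bornology.IsBounded (closure E.Ω)ᶜ) (hδ : 0 < E.δ) {k y' R : ℤ} (hyR : y' ≤ R)
    (hcol : ∀ j : ℤ, y' ≤ j → j ≤ R → E.IsInnerFace ![k, j]) :
    segment ℝ (cellCenter E.δ k y') (cellCenter E.δ k R) ⊆ E.Ω := by
  intro z hz
  obtain ⟨hre, him1, him2⟩ := re_im_of_mem_vertical_run hδ hyR hz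
  set n := ⌊z.im / E.δ⌋ with hn
  have hn1 : (n : ℝ) ≤ z.im / E.δ := Int.floor_le _
  have hn2 : z.im / E.δ < n + 1 := Int.lt_floor_add_one _
  have hzim : E.δ * n ≤ z.im ∧ z.im < E.δ * (n + 1) := by
    constructor
    · have := mul_le_mul_of_nonneg_left hn1 hδ.le; rwa [mul_div_cancel₀ _ hδ.ne'] at this
    · have := mul_lt_mul_of_pos_left hn2 hδ; rwa [mul_div_cancel₀ _ hδ.ne'] at this
  have hreI : z.re ∈ Ioo (E.δ * k) (E.δ * (k + 1)) := by
    rw [hre]; constructor <;> nlinarith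
  rcases eq_or_lt_of_le hzim.1 with heq | hlt
  · -- on the open side between `(k, n-1)` and `(k, n)`
    have hny : y' + 1 ≤ n := by
      have : (y' : ℝ) + 1 / 2 ≤ n := by
        by_contra h; push Not at h; nlinarith
      have : (2 * y' + 1 : ℤ) ≤ 2 * n := by exact_mod_cast (by linarith : (2 * y' + 1 : ℝ) ≤ 2 * n)
      omega
    have hnR : n ≤ R := by
      have : (n : ℝ) ≤ R + 1 / 2 := by nlinarith
      have : (2 * n : ℤ) ≤ 2 * R + 1 := by exact_mod_cast (by linarith : (2 * n : ℝ) ≤ 2 * R + 1)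
      omega
    refine mem_of_mem_open_side_h hΩ hJE hext hunb hδ (k := k) (j₀ := n) ?_ (hcol n (by omega) hnR) hreI heq.symm
    simpa using hcol (n - 1) (by omega) (by omega)
  · -- in the open cell `(k, n)`
    have hny : y' ≤ n := by
      have : (y' : ℝ) + 1 / 2 < n + 1 := by
        by_contra h; push Not at h; nlinarith
      have : (2 * y' + 1 : ℤ) < 2 * n + 2 := by exact_mod_cast (by linarith : (2 * y' + 1 : ℝ) < 2 * n + 2)
      omega
    have hnR : n ≤ R := by
      have : (n : ℝ) ≤ R + 1 / 2 := by nlinarith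
      have : (2 * n : ℤ) ≤ 2 * R + 1 := by exact_mod_cast (by linarith : (2 * n : ℝ) ≤ 2 * R + 1)
      omega
    refine isFull_of_isInnerFace hΩ hJE hext hunb hδ (hcol n hny hnR) ?_
    simp only [Matrix.cons_val_zero, Matrix.cons_val_one]
    exact mem_cell_iff.2 ⟨hreI, hlt, hzim.2⟩

/-- **Grid points of the vertical run are side midpoints**: a point of the run on the grid lines
is `(δ(k+½), δ n)` with `y' < n ≤ R`. [folklore] -/
theorem exists_eq_of_mem_vertical_run_of_mem_gridLines {δ : ℝ} (hδ : 0 < δ) {k y' R : ℤ}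
    (hyR : y' ≤ R) {z : ℂ} (hz : z ∈ segment ℝ (cellCenter δ k y') (cellCenter δ k R))
    (hg : z ∈ gridLines δ) : ∃ n : ℤ, y' + 1 ≤ n ∧ n ≤ R ∧ z = ⟨δ * (k + 1 / 2), δ * n⟩ := by
  obtain ⟨hre, him1, him2⟩ := re_im_of_mem_vertical_run hδ hyR hz
  rcases hg with ⟨m, hm⟩ | ⟨n, hn⟩
  · exact absurd (hre.symm.trans hm) (mul_add_half_ne_mul_int' hδ k m)
  · refine ⟨n, ?_, ?_, Complex.ext hre hn⟩
    · have : (y' : ℝ) + 1 / 2 ≤ n := by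
        by_contra h; push Not at h; rw [hn] at him1; nlinarith
      have : (2 * y' + 1 : ℤ) ≤ 2 * n := by exact_mod_cast (by linarith : (2 * y' + 1 : ℝ) ≤ 2 * n)
      omega
    · have : (n : ℝ) ≤ R + 1 / 2 := by rw [hn] at him2; nlinarith
      have : (2 * n : ℤ) ≤ 2 * R + 1 := by exact_mod_cast (by linarith : (2 * n : ℝ) ≤ 2 * R + 1)
      omega

/-! ### Lattice edges through a side midpoint -/

/-- Two sites with equal coordinates are equal. [folklore] -/
theorem site_ext {v w : Site 2} (h0 : v 0 = w 0) (h1 : v 1 = w 1) : v = w := by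
  funext l; fin_cases l <;> assumption

/-- **A closed lattice edge through the midpoint of a horizontal side is that side.** If the lattice
edge `[δx, δy]` contains `(δ(k+½), δ n)`, then `s(x, y) = s((k, n), (k+1, n))`. [folklore] -/
theorem sym2_eq_of_midpoint_mem_segment_h {δ : ℝ} (hδ : 0 < δ) {x y : Site 2}
    (h : (zdGraph 2).Adj x y) {k n : ℤ}
    (hm : (⟨δ * (k + 1 / 2), δ * n⟩ : ℂ) ∈ segment ℝ (meshPoint δ x) (meshPoint δ y)) :
    s(x, y) = s(![k, n], ![k + 1, n]) := by
  obtain ⟨i, hi, hl⟩ := exists_coord_eq_of_adj h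
  obtain ⟨a, b, ha, hb, hab, hv⟩ := hm
  have hre := congrArg Complex.re hv
  have him := congrArg Complex.im hv
  simp only [add_re, smul_re, meshPoint_re, add_im, smul_im, meshPoint_im, smul_eq_mul] at hre him
  have hre' : a * (x 0 : ℝ) + b * (y 0 : ℝ) = k + 1 / 2 := by
    have : δ * (a * (x 0 : ℝ) + b * (y 0 : ℝ)) = δ * (k + 1 / 2) := by rw [← hre]; ring
    exact mul_left_cancel₀ hδ.ne' this
  have him' : a * (x 1 : ℝ) + b * (y 1 : ℝ) = n := by
    have : δ * (a * (x 1 : ℝ) + b * (y 1 : ℝ)) = δ * n := by rw [← him]; ring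
    exact mul_left_cancel₀ hδ.ne' this
  fin_cases i
  · -- horizontal edge: `y 1 = x 1 = n`, `{x 0, y 0} = {k, k+1}`
    have h1 : y 1 = x 1 := hl 1 (by decide)
    have hx1 : x 1 = n := by
      have : a * (x 1 : ℝ) + b * (x 1 : ℝ) = n := by rw [← him', h1]
      rw [← add_mul, hab, one_mul] at this
      exact_mod_cast this
    have hy1 : y 1 = n := h1.trans hx1
    have hb1 : b ≤ 1 := by linarith
    rcases hi with hi | hi
    · -- `y 0 = x 0 + 1`
      have hi' : y 0 = x 0 + 1 := hi
      have hx0 : x 0 = k := by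
        have hy0 : (y 0 : ℝ) = x 0 + 1 := by exact_mod_cast hi'
        have e : (x 0 : ℝ) + b = k + 1 / 2 := by
          rw [hy0, show a * (x 0 : ℝ) + b * ((x 0 : ℝ) + 1) = (a + b) * x 0 + b by ring, hab, one_mul] at hre'
          exact hre'
        have : (2 * x 0 : ℤ) ≤ 2 * k + 1 := by exact_mod_cast (by linarith : (2 * x 0 : ℝ) ≤ 2 * k + 1)
        have : (2 * k + 1 : ℤ) ≤ 2 * x 0 + 2 := by exact_mod_cast (by linarith : (2 * k + 1 : ℝ) ≤ 2 * x 0 + 2)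
        omega
      have hx : x = ![k, n] := site_ext (by simp [hx0]) (by simp [hx1])
      have hy : y = ![k + 1, n] := site_ext (by simp; omega) (by simp [hy1])
      rw [hx, hy]
    · -- `x 0 = y 0 + 1`
      have hi' : x 0 = y 0 + 1 := hi
      have hy0' : y 0 = k := by
        have hx0 : (x 0 : ℝ) = y 0 + 1 := by exact_mod_cast hi'
        have e : (y 0 : ℝ) + a = k + 1 / 2 := by
          rw [hx0, show a * ((y 0 : ℝ) + 1) + b * (y 0 : ℝ) = (a + b) * y 0 + a by ring, hab, one_mul] at hre'
          exact hre'
        have : (2 * y 0 : ℤ) ≤ 2 * k + 1 := by exact_mod_cast (by linarith : (2 * y 0 : ℝ) ≤ 2 * k + 1)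
        have : (2 * k + 1 : ℤ) ≤ 2 * y 0 + 2 := by exact_mod_cast (by linarith : (2 * k + 1 : ℝ) ≤ 2 * y 0 + 2)
        omega
      have hx : x = ![k + 1, n] := site_ext (by simp; omega) (by simp [hx1])
      have hy : y = ![k, n] := site_ext (by simp [hy0']) (by simp [hy1])
      rw [hx, hy, Sym2.eq_swap]
  · -- vertical edge: `y 0 = x 0`, so `re` would be an integer multiple
    exfalso
    have h0 : y 0 = x 0 := hl 0 (by decide)
    have : a * (x 0 : ℝ) + b * (x 0 : ℝ) = k + 1 / 2 := by rw [← hre', h0]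
    rw [← add_mul, hab, one_mul] at this
    exact mul_add_half_ne_mul_int' hδ k (x 0) (by rw [this])

/-- **A closed lattice edge through the midpoint of a vertical side is that side.** If the lattice
edge `[δx, δy]` contains `(δ k, δ(n+½))`, then `s(x, y) = s((k, n), (k, n+1))`. [folklore] -/
theorem sym2_eq_of_midpoint_mem_segment_v {δ : ℝ} (hδ : 0 < δ) {x y : Site 2}
    (h : (zdGraph 2).Adj x y) {k n : ℤ}
    (hm : (⟨δ * k, δ * (n + 1 / 2)⟩ : ℂ) ∈ segment ℝ (meshPoint δ x) (meshPoint δ y)) :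
    s(x, y) = s(![k, n], ![k, n + 1]) := by
  obtain ⟨i, hi, hl⟩ := exists_coord_eq_of_adj h
  obtain ⟨a, b, ha, hb, hab, hv⟩ := hm
  have hre := congrArg Complex.re hv
  have him := congrArg Complex.im hv
  simp only [add_re, smul_re, meshPoint_re, add_im, smul_im, meshPoint_im, smul_eq_mul] at hre him
  have hre' : a * (x 0 : ℝ) + b * (y 0 : ℝ) = k := by
    have : δ * (a * (x 0 : ℝ) + b * (y 0 : ℝ)) = δ * k := by rw [← hre]; ring
    exact mul_left_cancel₀ hδ.ne' this
  have him' : a * (x 1 : ℝ) + b * (y 1 : ℝ) = n + 1 / 2 := by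
    have : δ * (a * (x 1 : ℝ) + b * (y 1 : ℝ)) = δ * (n + 1 / 2) := by rw [← him]; ring
    exact mul_left_cancel₀ hδ.ne' this
  fin_cases i
  · -- horizontal edge: `im` would be an integer multiple
    exfalso
    have h1 : y 1 = x 1 := hl 1 (by decide)
    have : a * (x 1 : ℝ) + b * (x 1 : ℝ) = n + 1 / 2 := by rw [← him', h1]
    rw [← add_mul, hab, one_mul] at this
    exact mul_add_half_ne_mul_int' hδ n (x 1) (by rw [this])
  · have h0 : y 0 = x 0 := hl 0 (by decide)
    have hx0 : x 0 = k := by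
      have : a * (x 0 : ℝ) + b * (x 0 : ℝ) = k := by rw [← hre', h0]
      rw [← add_mul, hab, one_mul] at this
      exact_mod_cast this
    have hy0 : y 0 = k := h0.trans hx0
    have hb1 : b ≤ 1 := by linarith
    rcases hi with hi | hi
    · have hi' : y 1 = x 1 + 1 := hi
      have hx1 : x 1 = n := by
        have hy1 : (y 1 : ℝ) = x 1 + 1 := by exact_mod_cast hi'
        have e : (x 1 : ℝ) + b = n + 1 / 2 := by
          rw [hy1, show a * (x 1 : ℝ) + b * ((x 1 : ℝ) + 1) = (a + b) * x 1 + b by ring, hab, one_mul] at him'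
          exact him'
        have : (2 * x 1 : ℤ) ≤ 2 * n + 1 := by exact_mod_cast (by linarith : (2 * x 1 : ℝ) ≤ 2 * n + 1)
        have : (2 * n + 1 : ℤ) ≤ 2 * x 1 + 2 := by exact_mod_cast (by linarith : (2 * n + 1 : ℝ) ≤ 2 * x 1 + 2)
        omega
      have hx : x = ![k, n] := site_ext (by simp [hx0]) (by simp [hx1])
      have hy : y = ![k, n + 1] := site_ext (by simp [hy0]) (by simp; omega)
      rw [hx, hy]
    · have hi' : x 1 = y 1 + 1 := hi
      have hy1 : y 1 = n := by
        have hx1 : (x 1 : ℝ) = y 1 + 1 := by exact_mod_cast hi'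
        have e : (y 1 : ℝ) + a = n + 1 / 2 := by
          rw [hx1, show a * ((y 1 : ℝ) + 1) + b * (y 1 : ℝ) = (a + b) * y 1 + a by ring, hab, one_mul] at him'
          exact him'
        have : (2 * y 1 : ℤ) ≤ 2 * n + 1 := by exact_mod_cast (by linarith : (2 * y 1 : ℝ) ≤ 2 * n + 1)
        have : (2 * n + 1 : ℤ) ≤ 2 * y 1 + 2 := by exact_mod_cast (by linarith : (2 * n + 1 : ℝ) ≤ 2 * y 1 + 2)
        omega
      have hx : x = ![k, n + 1] := site_ext (by simp [hx0]) (by simp; omega)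
      have hy : y = ![k, n] := site_ext (by simp [hy0]) (by simp [hy1])
      rw [hx, hy, Sym2.eq_swap]

/-! ### Faces of a lattice edge -/

/-- **The two faces of a horizontal lattice edge**: a face cornered at `(k, n)` and `(k+1, n)` is
`(k, n)` or `(k, n-1)`. [folklore] -/
theorem face_eq_of_isCorner_h {k n : ℤ} {f : Site 2} (h₁ : IsCorner ![k, n] f)
    (h₂ : IsCorner ![k + 1, n] f) : f = ![k, n] ∨ f = ![k, n - 1] := by
  have a0 := h₁ 0; have a1 := h₁ 1; have b0 := h₂ 0
  simp only [Matrix.cons_val_zero, Matrix.cons_val_one] at a0 a1 b0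
  have hf0 : f 0 = k := by omega
  rcases a1 with h | h
  · left; exact site_ext (by simp [hf0]) (by simp [h])
  · right; exact site_ext (by simp [hf0]) (by simp; omega)

/-- **The two faces of a vertical lattice edge**: a face cornered at `(k, n)` and `(k, n+1)` is
`(k, n)` or `(k-1, n)`. [folklore] -/
theorem face_eq_of_isCorner_v {k n : ℤ} {f : Site 2} (h₁ : IsCorner ![k, n] f)
    (h₂ : IsCorner ![k, n + 1] f) : f = ![k, n] ∨ f = ![k - 1, n] := by
  have a0 := h₁ 0; have a1 := h₁ 1; have b1 := h₂ 1
  simp only [Matrix.cons_val_zero, Matrix.cons_val_one] at a0 a1 b1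
  have hf1 : f 1 = n := by omega
  rcases a0 with h | h
  · left; exact site_ext (by simp [h]) (by simp [hf1])
  · right; exact site_ext (by simp; omega) (by simp [hf1])

/-! ### Horizontal steps between two cell centres -/

/-- Coordinates on the horizontal step from the centre of `(k, j)` to the centre of `(k+1, j)`:
`im = δ(j+½)`, `re ∈ [δ(k+½), δ(k+3/2)]`. [folklore] -/
theorem re_im_of_mem_horizontal_step {δ : ℝ} (hδ : 0 < δ) {k j : ℤ} {z : ℂ}
    (hz : z ∈ segment ℝ (cellCenter δ k j) (cellCenter δ (k + 1) j)) :
    z.im = δ * (j + 1 / 2) ∧ δ * (k + 1 / 2) ≤ z.re ∧ z.re ≤ δ * (k + 3 / 2) := by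
  rw [segment_eq_image'] at hz
  obtain ⟨θ, ⟨h0, h1⟩, rfl⟩ := hz
  simp only [add_re, add_im, Complex.real_smul, mul_re, mul_im, ofReal_re, ofReal_im, zero_mul,
    sub_zero, add_zero, sub_re, sub_im, cellCenter_re, cellCenter_im]
  push_cast
  refine ⟨by ring, ?_, ?_⟩ <;> nlinarith [mul_nonneg hδ.le h0, mul_nonneg hδ.le (sub_nonneg.2 h1)]

/-- **The horizontal step across the common side of two inner cells lies in `Ω`** (regular `Ω`).
[folklore] -/
theorem horizontal_step_subset {E : DiscreteDobrushin} (hΩ : IsOpen E.Ω)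
    (hJE : frontier E.Ω ⊆ closure (closure E.Ω)ᶜ) (hext : IsConnected (closure E.Ω)ᶜ)
    (hunb : ¬ Bornology.IsBounded (closure E.Ω)ᶜ) (hδ : 0 < E.δ) {k j : ℤ}
    (h₁ : E.IsInnerFace ![k, j]) (h₂ : E.IsInnerFace ![k + 1, j]) :
    segment ℝ (cellCenter E.δ k j) (cellCenter E.δ (k + 1) j) ⊆ E.Ω := by
  intro z hz
  obtain ⟨him, hre1, hre2⟩ := re_im_of_mem_horizontal_step hδ hz
  have h1 : E.δ * (↑(k + 1) - 1) < z.re := by push_cast; nlinarith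
  have h2 : z.re < E.δ * (↑(k + 1) + 1) := by push_cast; nlinarith
  have h3 : E.δ * j < z.im := by rw [him]; nlinarith
  have h4 : z.im < E.δ * (j + 1) := by rw [him]; nlinarith
  exact rect_subset_of_isInnerFace_v hΩ hJE hext hunb hδ (k₀ := k + 1) (j := j) (by simpa using h₁) h₂
    (mem_reProdIm.2 ⟨⟨h1, h2⟩, h3, h4⟩)

/-- **Grid points of a horizontal step**: the only point of the step on the grid lines is the
midpoint `(δ(k+1), δ(j+½))` of the common side. [folklore] -/
theorem eq_of_mem_horizontal_step_of_mem_gridLines {δ : ℝ} (hδ : 0 < δ) {k j : ℤ} {z : ℂ}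
    (hz : z ∈ segment ℝ (cellCenter δ k j) (cellCenter δ (k + 1) j)) (hg : z ∈ gridLines δ) :
    z = ⟨δ * (k + 1), δ * (j + 1 / 2)⟩ := by
  obtain ⟨him, hre1, hre2⟩ := re_im_of_mem_horizontal_step hδ hz
  rcases hg with ⟨m, hm⟩ | ⟨n, hn⟩
  · refine Complex.ext ?_ him
    rw [hm]
    have h1 : (k : ℝ) + 1 / 2 ≤ m := by
      by_contra h; push Not at h; rw [hm] at hre1; nlinarith
    have h2 : (m : ℝ) ≤ k + 3 / 2 := by rw [hm] at hre2; nlinarith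
    have : (2 * k + 1 : ℤ) ≤ 2 * m := by exact_mod_cast (by linarith : (2 * k + 1 : ℝ) ≤ 2 * m)
    have : (2 * m : ℤ) ≤ 2 * k + 3 := by exact_mod_cast (by linarith : (2 * m : ℝ) ≤ 2 * k + 3)
    have : m = k + 1 := by omega
    rw [this]; push_cast; ring
  · exact absurd (him.symm.trans hn) (mul_add_half_ne_mul_int' hδ j n)

end Summit.CriticalPhenomena.CardyFormulaZ2.Theorems.DiscretisationFamilyExists

end
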